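import Literature.MathematicalPhysics.PowerSystems.DCFlowDoubleLineOutage
import Literature.MathematicalPhysics.PowerSystems.DCFlowLineModification
import Literature.MathematicalPhysics.PowerSystems.ResistanceDistanceMetric
import HarnessLib

/-!
# Failure localization in DC power flow: a line outage (or any line modification) does not propagate
# across a cut vertex, bridges never see other lines' contingencies, and across a cut vertex the
# effects of two simultaneous outages superpose (Guo–Liang–Zocca–Low–Wierman, Part I §4)

Topic `Literature/MathematicalPhysics/PowerSystems`; namespaces `…PowerSystems.KronReduction` (§1:
transfer potentials and transfer factors across a separating node) and `…PowerSystems.ClassicalModel`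
(§2–§4: the DC model).  Ninth file of the DC line-outage story; it reuses `DCFlowLineOutageFactor.lean`
(transfer potentials, reciprocity, `dcFlow_lineOutage_transfer`, `laplacian_mulVec_eq_mulVec_iff`),
`DCFlowLineOutageBounds.lean` (`c_mn|v_m − v_n| ≤ 1 − c_pq𝓡_pq`, `c𝓡 = 1 ⟺` bridge),
`DCFlowDoubleLineOutage.lean` (`dcFlow_doubleOutage_glodf`), `DCFlowLineModification.lean`
(`dcFlow_lineModification_transfer`) and `ResistanceDistanceMetric.lean` (resistances add across a
separating node ⟺ the transfer potential is flat there).  Everything below is PROVED: 0 definitions,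
0 named facts, 0 `sorry`, no new axiom.

SOURCES (read on the page).
* [GuoEtAl2020] arXiv:2005.10199 §2.3 Definition 1 (p0005 L57–L71, p0006 L1): «let `𝔯` be the relation
  on the edges … `l₁ 𝔯 l₂` if … they belong to a common simple cycle … The subgraphs … induced by the
  equivalence classes of `𝔯` are called blocks … A node of `G` that is part of two or more blocks is
  called a cut vertex … An edge in a singleton equivalent class is called a bridge … The removal of a
  cut vertex disconnects `G`. … Two non-bridge blocks are connected either by a bridge or by a cut
  vertex»; §4.1 **Theorem 8** (Simple Cycle Criterion, p0011 L8–L21): «the outage of line `l̂` will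
  impact the branch flow on line `l`, i.e., `K_{l l̂} ≠ 0`, only if there is a simple cycle in `G` that
  contains both lines» (the converse only «almost surely»); §4.2 (p0011 L26–L38) **Corollary 9**
  «Suppose a single non-bridge line `l̂` trips … LODF `K_{l l̂} = 0` if `l` and `l̂` are in different
  blocks of `G`. PTDF `D_{l l̂} = 0` if and only if `K_{l l̂} = 0`», «since a bridge is a block, a
  non-bridge outage will not impact the branch flow on any other bridge»; **Theorem 10** (p0012
  L37–L68): «GLODF `K^F_{l l̂} = 0` if `l` and `l̂` are in different blocks … `K^F` has a block diagonal
  structure … `K^F_k := D_{−k}(I − D_k)⁻¹` … a non-cut outage does not impact the branch flow on any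
  bridge».
* [SchaferEtAl2022] arXiv:2209.13278 (p0005 L18–L19): the flow change of a reinforcement is a cycle
  flow (so it, too, stays inside the block — §3 below).

RENDERING.  Conductance network `c` (`IsConductance c`), `L = diagonal (nodeConductance c) − c`, `hG :
G.Adj x y ↔ x ≠ y ∧ c x y ≠ 0`, `G` connected.  «`l = {m,n}` and `l̂ = {p,q}` lie in different blocks»
is rendered by its cut-vertex witness: a node `a` with `∀ W : G.Walk m p, a ∈ W.support` and likewise
for the pairs `(m,q)`, `(n,p)`, `(n,q)` — every walk from an endpoint of `l` to an endpoint of `l̂`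
passes through `a` (`a` may be an endpoint; for two distinct lines of a connected graph this is
equivalent to «no simple cycle contains both», a graph-theoretic translation NOT typed here).  Transfer
potentials `Lu = e_p − e_q`; transfer factor of the ordered pair `(m,n)` for `(p,q)`: `c(m,n)(u_m −
u_n)`; outage / modification operating points as in the earlier files (`L'θ' = P` with `L' = L −
c_pqνν^ᵀ`, resp. `L + Δbνν^ᵀ`).

WHAT IS PROVED (0 `def`, 0 named facts, 0 `sorry`).
* §1 ★★★ **`transferPotential_eq_of_separates`** (if every walk from `x` to `p` and from `x` to `q`
  passes through `a`, the `(p,q)`-transfer potential has `u_x = u_a`: the far side of a cut vertex is an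
  equipotential), ★★★ **`transferFactor_eq_zero_of_separates`** (hence `D_{(mn),(pq)} = c_mn(u_m − u_n)
  = 0` for a pair `(m,n)` beyond the cut vertex — «PTDF `D_{l l̂} = 0`»), ★★★
  **`transferPotential_sub_eq_zero_of_bridge`** (a bridge `{m,n}` carries nothing of any OTHER line's
  transfer: `u_m = u_n` — «a bridge is a block»).
* §2 THE MODEL, single outage: ★★★ **`dcFlow_lineOutage_angles_eq_of_separates`** (after the outage
  of `{p,q}`, EVERY angle difference `θ'_m − θ'_n` between nodes separated from `{p,q}` by `a` is
  unchanged — no hypothesis on bridges needed once a post-outage solution exists), ★★★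
  **`dcFlow_lineOutage_flowChange_eq_zero_of_separates`** («LODF `K_{l l̂} = 0` if `l` and `l̂` are in
  different blocks»: `ΔF_mn = 0`), ★★★ **`dcFlow_lineOutage_bridgeFlow_eq`** (the flow on a bridge
  other than the tripped line never changes).
* §3 THE MODEL, modification: ★★ `dcFlow_lineModification_angles_eq_of_separates`, ★★
  `dcFlow_lineModification_bridgeFlow_eq` (the same two localisation statements for any `Δb`:
  reinforcement, new parallel capacity, derating).
* §4 THE MODEL, N−2 across a cut vertex: ★★★ **`dcFlow_doubleOutage_superposition_of_separates`**
  (if `a` separates `ℓ₂ = {r,s}` from `ℓ₁ = {p,q}` then `D₁₂ = D₂₁ = 0`, `det(I − D_{FF}) = (1 − D₁₁)(1 −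
  D₂₂)`, and for every ordered pair `(1 − D₁₁)(1 − D₂₂)·ΔF_mn = D_{(mn),1}(1 − D₂₂)f₁ + D_{(mn),2}(1 −
  D₁₁)f₂` — the two single-outage LODF effects superpose: Theorem 10's block-diagonal `K^F` for `|F| =
  2`).

PROOF ROUTE.  §1: write the `(p,q)` transfer as `(a,q)` minus `(a,p)` transfers (superposition,
uniqueness up to constants); for each, `ResistanceDistanceMetric`'s «resistances add across a
separating node» is, electrically, flatness of the potential at `x` (`effectiveResistance_add_eq_of_separates` +
`effectiveResistance_triangle_eq_iff_potential`); the bridge statement is the `1 − c𝓡 = 0` bound of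
`DCFlowLineOutageBounds` plus reciprocity.  §2–§3: `θ' − θ = F̂·u + κ𝟙` (resp. `−Δb(θ'_p − θ'_q)·u +
κ𝟙`) by `dcFlow_lineOutage_transfer` / `dcFlow_lineModification_transfer` and
`laplacian_mulVec_eq_mulVec_iff`, so angle differences change by `F̂(u_m − u_n) = 0`.  §4:
`dcFlow_doubleOutage_glodf` with `D₁₂ = D₂₁ = 0`.  In-seat exact cross-check
(`negtest/dcflow_localization_check.py`, python `Fraction`s): 40 random networks glued from two
cyclic blocks (with chords) at a cut vertex plus a pendant path of bridges; for every line as outage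
(non-bridge) and as modification (random `Δb > 0`) and every far-side pair: flat potentials, zero
transfer factors, unchanged far angle differences and bridge flows; and for random line pairs in the two
blocks the vanishing cross factors and the N−2 superposition (multiplied and divided), all against
DIRECT solves — 16 410 checks, 0 failures.

THREE COLUMNS.  CERTIFIED (kernel theorems, exact data): equipotential far sides, vanishing transfer
factors across a cut vertex and on bridges, invariance of far-side angle differences and bridge flows
under an outage or a modification, N−2 superposition across a cut vertex.  MODELLED: DC (linearised,
lossless) power flow with fixed injections; contingency = deletion / re-weighting of one or two
susceptances; instantaneous, no dynamics / limits / protection.  VALIDATED: nothing numerical in Lean.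
NOT CLAIMED: the graph-theoretic equivalence «different blocks ⟺ separated by a cut vertex» (Menger /
block decomposition) — the hypothesis is stated through the cut vertex; the «if» («almost surely»)
half of Theorem 8; Theorem 6 (spanning-forest formula); tree-partition results of [GuoEtAl2018];
`|F| ≥ 3`; AC power flow.

## References
* [GuoEtAl2020] L. Guo, C. Liang, A. Zocca, S. H. Low, A. Wierman, *Line failure localization of power
  networks, Part I: Non-cut outages*, IEEE Trans. Power Syst. 36 (2021), arXiv:2005.10199 — §2.3
  Definition 1, §4.1 Theorem 8, §4.2 Corollary 9, Theorem 10.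
* [GuoEtAl2018] L. Guo, C. Liang, A. Zocca, S. H. Low, A. Wierman, *Failure localization in power
  systems via tree partitions*, IEEE CDC 2018, arXiv:1803.08551 — §2, §6.
* [SchaferEtAl2022] B. Schäfer et al., Nat. Commun. 13 (2022) 5396, arXiv:2209.13278.
* [KirklandNeumann2012] S. J. Kirkland, M. Neumann, *Group Inverses of M-Matrices and Their
  Applications*, CRC 2012 — §7.4 (equality case of the triangle inequality).
-/

noncomputable section

open scoped Matrix
open Finset Matrix

namespace Literature.MathematicalPhysics.PowerSystems

namespace KronReduction

open Literature.Probability.MarkovChains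

variable {X : Type*} [Fintype X] [DecidableEq X] {c : Matrix X X ℝ}

/-! ### §1. Transfer potentials are flat beyond a cut vertex; bridges carry no foreign transfer -/

section Separation

/-- ★★★ **THE FAR SIDE OF A CUT VERTEX IS AN EQUIPOTENTIAL OF EVERY TRANSFER ON THE NEAR SIDE**: if
every walk from `x` to `p` and every walk from `x` to `q` passes through the node `a`, then the
transfer potential `u` of `(p,q)` satisfies `u_x = u_a` («The removal of a cut vertex disconnects `G`»;
the `(p,q)` transfer is the `(a,q)` transfer minus the `(a,p)` transfer, and each is flat at `x` by the
equality case of the resistance triangle inequality).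
[cite: GuoEtAl2020, §2.3 Definition 1 (cut vertex; arXiv:2005.10199 p0005 L65–L71, p0006 L1), §4.2 Corollary 9 (p0011 L30–L36); KirklandNeumann2012, §7.4 (equality case, held text p0184 L1–L7)] -/
theorem transferPotential_eq_of_separates (hc : IsConductance c) {G : SimpleGraph X}
    (hG : ∀ x y, G.Adj x y ↔ x ≠ y ∧ c x y ≠ 0) (hconn : G.Connected) {p q a x : X} {u : X → ℝ}
    (hu : (Matrix.diagonal (nodeConductance c) - c) *ᵥ u = Pi.single p 1 - Pi.single q 1)
    (hp : ∀ W : G.Walk x p, a ∈ W.support) (hq : ∀ W : G.Walk x q, a ∈ W.support) :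
    u x = u a := by
  obtain ⟨u₁, hu₁⟩ := exists_transferPotential hc hG hconn a q
  obtain ⟨u₂, hu₂⟩ := exists_transferPotential hc hG hconn a p
  -- flatness of the two elementary transfers at `x`
  have h₁ : u₁ x = u₁ a :=
    (effectiveResistance_triangle_eq_iff_potential hc hG hconn hu₁).1
      (effectiveResistance_add_eq_of_separates hc hG hconn hq)
  have h₂ : u₂ x = u₂ a :=
    (effectiveResistance_triangle_eq_iff_potential hc hG hconn hu₂).1
      (effectiveResistance_add_eq_of_separates hc hG hconn hp)
  -- `u = u₁ − u₂ + κ`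
  have hL : (Matrix.diagonal (nodeConductance c) - c) *ᵥ u
      = (Matrix.diagonal (nodeConductance c) - c) *ᵥ (u₁ - u₂) := by
    rw [Matrix.mulVec_sub, hu₁, hu₂, hu]
    abel
  obtain ⟨κ, hκ⟩ := (laplacian_mulVec_eq_mulVec_iff hc hG hconn _ _).1 hL.symm
  have hx := hκ x
  have ha := hκ a
  simp only [Pi.sub_apply] at hx ha
  linarith

/-- ★★★ **TRANSFER FACTORS VANISH ACROSS A CUT VERTEX** («PTDF `D_{l l̂} = 0`» when `l` and `l̂` are in
different blocks): if every walk from `m` and from `n` to `p` and to `q` passes through `a`, then `u_m =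
u_n` for the `(p,q)` transfer potential, so the factor `c(m,n)(u_m − u_n)` of the ordered pair `(m,n)`
is `0` (and by reciprocity so is the factor of `(p,q)` for the `(m,n)` transfer).
[cite: GuoEtAl2020, §4.2 Corollary 9 («PTDF `D_{l l̂} = 0` if and only if `K_{l l̂} = 0`», arXiv:2005.10199 p0011 L30–L36), §4.1 Theorem 8 (only-if half, p0011 L8–L21)] -/
theorem transferFactor_eq_zero_of_separates (hc : IsConductance c) {G : SimpleGraph X}
    (hG : ∀ x y, G.Adj x y ↔ x ≠ y ∧ c x y ≠ 0) (hconn : G.Connected) {p q a m n : X} {u : X → ℝ}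
    (hu : (Matrix.diagonal (nodeConductance c) - c) *ᵥ u = Pi.single p 1 - Pi.single q 1)
    (hmp : ∀ W : G.Walk m p, a ∈ W.support) (hmq : ∀ W : G.Walk m q, a ∈ W.support)
    (hnp : ∀ W : G.Walk n p, a ∈ W.support) (hnq : ∀ W : G.Walk n q, a ∈ W.support) :
    u m = u n ∧ c m n * (u m - u n) = 0 := by
  have hm := transferPotential_eq_of_separates hc hG hconn hu hmp hmq
  have hn := transferPotential_eq_of_separates hc hG hconn hu hnp hnq
  refine ⟨by rw [hm, hn], ?_⟩
  rw [hm, hn, sub_self, mul_zero]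

omit [Fintype X] [DecidableEq X] in
/-- `s(m,n) ≠ s(p,q)` unfolded. [folklore] -/
private theorem ne_line₂₂ {p q m n : X} (hne : s(m, n) ≠ s(p, q)) :
    ¬ (m = p ∧ n = q) ∧ ¬ (m = q ∧ n = p) := by
  rw [Ne, Sym2.eq_iff] at hne
  exact not_or.1 hne

/-- ★★★ **A BRIDGE CARRIES NOTHING OF ANY OTHER LINE'S TRANSFER** («since a bridge is a block, a
non-bridge outage will not impact the branch flow on any other bridge»): if `{m,n}` is a bridge (`m`,
`n` not joined in `G` minus the line) and `{p,q} ≠ {m,n}` is a line, then the `(p,q)` transfer potential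
has `u_m = u_n`.  Proof: by reciprocity `u_m − u_n = w_p − w_q` for the bridge's own transfer `w`, and
that transfer puts no flow on any other line (`c_pq|w_p − w_q| ≤ 1 − c_mn𝓡(m ↔ n) = 0`).
[cite: GuoEtAl2020, §4.2 (arXiv:2005.10199 p0011 L31–L32), §2.3 Definition 1 (bridge = singleton block, p0005 L71)] -/
theorem transferPotential_sub_eq_zero_of_bridge (hc : IsConductance c) {G : SimpleGraph X}
    (hG : ∀ x y, G.Adj x y ↔ x ≠ y ∧ c x y ≠ 0) (hconn : G.Connected) {p q m n : X} (hmn : m ≠ n)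
    (hcmn : c m n ≠ 0) (hbr : ¬ (G.deleteEdges {s(m, n)}).Reachable m n) (hcpq : c p q ≠ 0)
    (hne : s(m, n) ≠ s(p, q)) {u : X → ℝ}
    (hu : (Matrix.diagonal (nodeConductance c) - c) *ᵥ u = Pi.single p 1 - Pi.single q 1) :
    u m = u n := by
  obtain ⟨w, hw⟩ := exists_transferPotential hc hG hconn m n
  have hone : c m n * effectiveResistance c m n = 1 :=
    (conductance_mul_effectiveResistance_lt_one_iff_reachable hc hG hconn hmn hcmn).2.2 hbr
  obtain ⟨h1, h2⟩ := ne_line₂₂ (Ne.symm hne)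
  have hle := conductance_mul_transferPotential_sub_le hc hG hconn hmn hw h1 h2
  rw [hone, sub_self] at hle
  have h0 : c p q * |w p - w q| = 0 := le_antisymm hle (mul_nonneg (hc.nonneg p q) (abs_nonneg _))
  have hw0 : w p - w q = 0 := by
    rcases mul_eq_zero.1 h0 with h | h
    · exact absurd h hcpq
    · exact abs_eq_zero.1 h
  have hrec : u m - u n = w p - w q := transferPotential_reciprocity hc hu hw
  linarith

end Separation

end KronReduction

/-! ### §2. THE MODEL: a single outage does not propagate across a cut vertex or onto a bridge -/

namespace ClassicalModel

open KronReduction Literature.Probability.MarkovChains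

variable {X : Type*} [Fintype X] [DecidableEq X] {c : Matrix X X ℝ}

/-- The post-outage angle change is the transfer potential scaled by the fictitious flow, up to a
uniform shift: `Δ(θ_m − θ_n) = F̂·(u_m − u_n)`. [cite: StrakeEtAl2019, §3.3 eqs. (11)–(12) (arXiv:1811.08683 p0005 L89–L96)] -/
theorem dcFlow_lineOutage_angleChange (hc : IsConductance c) {G : SimpleGraph X}
    (hG : ∀ x y, G.Adj x y ↔ x ≠ y ∧ c x y ≠ 0) (hconn : G.Connected) {p q : X} {L' : Matrix X X ℝ}
    (hL' : L' = (Matrix.diagonal (nodeConductance c) - c)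
        - c p q • Matrix.vecMulVec (Pi.single p (1 : ℝ) - Pi.single q 1) (Pi.single p (1 : ℝ) - Pi.single q 1))
    {P θ θ' u : X → ℝ} (hθ : (Matrix.diagonal (nodeConductance c) - c) *ᵥ θ = P) (hθ' : L' *ᵥ θ' = P)
    (hu : (Matrix.diagonal (nodeConductance c) - c) *ᵥ u = Pi.single p 1 - Pi.single q 1) (m n : X) :
    (θ' m - θ' n) - (θ m - θ n) = c p q * (θ' p - θ' q) * (u m - u n) := by
  have h1 := (dcFlow_lineOutage_transfer hL' hθ hθ').1
  have h2 : (Matrix.diagonal (nodeConductance c) - c) *ᵥ (θ' - θ)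
      = (Matrix.diagonal (nodeConductance c) - c) *ᵥ ((c p q * (θ' p - θ' q)) • u) := by
    rw [Matrix.mulVec_smul, hu, h1]
  obtain ⟨κ, hκ⟩ := (laplacian_mulVec_eq_mulVec_iff hc hG hconn _ _).1 h2.symm
  have hm := hκ m
  have hn := hκ n
  simp only [Pi.sub_apply, Pi.smul_apply, smul_eq_mul] at hm hn
  linarith

/-- ★★★ **AN OUTAGE DOES NOT PROPAGATE ACROSS A CUT VERTEX — ANGLES**: if the line `{p,q}` trips
(`Lθ = P` before, `L'θ' = P` after) and the nodes `m`, `n` are separated from `p` and `q` by a node `a`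
(every walk from `m` or `n` to `p` or `q` passes through `a`), then `θ'_m − θ'_n = θ_m − θ_n` — the whole
far side keeps its state (no bridge hypothesis: whenever a post-outage solution exists).
[cite: GuoEtAl2020, §4.2 Corollary 9 and Theorem 8 (only-if half) (arXiv:2005.10199 p0011 L8–L36), §2.3 («The removal of a cut vertex disconnects `G`», p0006 L1)] -/
theorem dcFlow_lineOutage_angles_eq_of_separates (hc : IsConductance c) {G : SimpleGraph X}
    (hG : ∀ x y, G.Adj x y ↔ x ≠ y ∧ c x y ≠ 0) (hconn : G.Connected) {p q a m n : X}
    {L' : Matrix X X ℝ}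
    (hL' : L' = (Matrix.diagonal (nodeConductance c) - c)
        - c p q • Matrix.vecMulVec (Pi.single p (1 : ℝ) - Pi.single q 1) (Pi.single p (1 : ℝ) - Pi.single q 1))
    {P θ θ' : X → ℝ} (hθ : (Matrix.diagonal (nodeConductance c) - c) *ᵥ θ = P) (hθ' : L' *ᵥ θ' = P)
    (hmp : ∀ W : G.Walk m p, a ∈ W.support) (hmq : ∀ W : G.Walk m q, a ∈ W.support)
    (hnp : ∀ W : G.Walk n p, a ∈ W.support) (hnq : ∀ W : G.Walk n q, a ∈ W.support) :
    θ' m - θ' n = θ m - θ n := by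
  obtain ⟨u, hu⟩ := exists_transferPotential hc hG hconn p q
  have h := dcFlow_lineOutage_angleChange hc hG hconn hL' hθ hθ' hu m n
  rw [(transferFactor_eq_zero_of_separates hc hG hconn hu hmp hmq hnp hnq).1, sub_self, mul_zero,
    sub_eq_zero] at h
  exact h

/-- ★★★ **«LODF `K_{l l̂} = 0` IF `l` AND `l̂` ARE IN DIFFERENT BLOCKS»**: under the same separation,
the flow on the surviving line `(m,n)` does not change: `c(m,n)[(θ'_m − θ'_n) − (θ_m − θ_n)] = 0`.
[cite: GuoEtAl2020, §4.2 Corollary 9 (arXiv:2005.10199 p0011 L30–L36), §4.1 Theorem 8 (p0011 L19–L21)] -/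
theorem dcFlow_lineOutage_flowChange_eq_zero_of_separates (hc : IsConductance c) {G : SimpleGraph X}
    (hG : ∀ x y, G.Adj x y ↔ x ≠ y ∧ c x y ≠ 0) (hconn : G.Connected) {p q a m n : X}
    {L' : Matrix X X ℝ}
    (hL' : L' = (Matrix.diagonal (nodeConductance c) - c)
        - c p q • Matrix.vecMulVec (Pi.single p (1 : ℝ) - Pi.single q 1) (Pi.single p (1 : ℝ) - Pi.single q 1))
    {P θ θ' : X → ℝ} (hθ : (Matrix.diagonal (nodeConductance c) - c) *ᵥ θ = P) (hθ' : L' *ᵥ θ' = P)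
    (hmp : ∀ W : G.Walk m p, a ∈ W.support) (hmq : ∀ W : G.Walk m q, a ∈ W.support)
    (hnp : ∀ W : G.Walk n p, a ∈ W.support) (hnq : ∀ W : G.Walk n q, a ∈ W.support) :
    c m n * ((θ' m - θ' n) - (θ m - θ n)) = 0 := by
  rw [dcFlow_lineOutage_angles_eq_of_separates hc hG hconn hL' hθ hθ' hmp hmq hnp hnq, sub_self,
    mul_zero]

/-- ★★★ **BRIDGES ARE BLIND TO OTHER LINES' OUTAGES**: if `{m,n}` is a bridge and a different line
`{p,q}` trips, the bridge's angle difference and flow are unchanged: `θ'_m − θ'_n = θ_m − θ_n` (the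
bridge flow is the net injection of one side, which the outage does not alter).
[cite: GuoEtAl2020, §4.2 («since a bridge is a block, a non-bridge outage will not impact the branch flow on any other bridge», arXiv:2005.10199 p0011 L31–L32), Theorem 10 («a non-cut outage does not impact the branch flow on any bridge», p0012 L68)] -/
theorem dcFlow_lineOutage_bridgeFlow_eq (hc : IsConductance c) {G : SimpleGraph X}
    (hG : ∀ x y, G.Adj x y ↔ x ≠ y ∧ c x y ≠ 0) (hconn : G.Connected) {p q m n : X} (hmn : m ≠ n)
    (hcmn : c m n ≠ 0) (hbr : ¬ (G.deleteEdges {s(m, n)}).Reachable m n) (hcpq : c p q ≠ 0)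
    (hne : s(m, n) ≠ s(p, q)) {L' : Matrix X X ℝ}
    (hL' : L' = (Matrix.diagonal (nodeConductance c) - c)
        - c p q • Matrix.vecMulVec (Pi.single p (1 : ℝ) - Pi.single q 1) (Pi.single p (1 : ℝ) - Pi.single q 1))
    {P θ θ' : X → ℝ} (hθ : (Matrix.diagonal (nodeConductance c) - c) *ᵥ θ = P) (hθ' : L' *ᵥ θ' = P) :
    θ' m - θ' n = θ m - θ n ∧ c m n * (θ' m - θ' n) = c m n * (θ m - θ n) := by
  obtain ⟨u, hu⟩ := exists_transferPotential hc hG hconn p q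
  have h := dcFlow_lineOutage_angleChange hc hG hconn hL' hθ hθ' hu m n
  rw [transferPotential_sub_eq_zero_of_bridge hc hG hconn hmn hcmn hbr hcpq hne hu, sub_self,
    mul_zero, sub_eq_zero] at h
  exact ⟨h, by rw [h]⟩

/-! ### §3. THE MODEL: the same localisation for any line modification -/

/-- The post-modification angle change is the transfer potential scaled by the fictitious transfer:
`Δ(θ_m − θ_n) = −Δb(θ'_p − θ'_q)·(u_m − u_n)`. [cite: ManikEtAl2017, §4.1 (`ξ = κL_st T q_st`, arXiv:1609.04310 p0006 L59–L63)] -/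
theorem dcFlow_lineModification_angleChange (hc : IsConductance c) {G : SimpleGraph X}
    (hG : ∀ x y, G.Adj x y ↔ x ≠ y ∧ c x y ≠ 0) (hconn : G.Connected) {p q : X} {Δb : ℝ}
    {L' : Matrix X X ℝ}
    (hL' : L' = (Matrix.diagonal (nodeConductance c) - c)
        + Δb • Matrix.vecMulVec (Pi.single p (1 : ℝ) - Pi.single q 1) (Pi.single p (1 : ℝ) - Pi.single q 1))
    {P θ θ' u : X → ℝ} (hθ : (Matrix.diagonal (nodeConductance c) - c) *ᵥ θ = P) (hθ' : L' *ᵥ θ' = P)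
    (hu : (Matrix.diagonal (nodeConductance c) - c) *ᵥ u = Pi.single p 1 - Pi.single q 1) (m n : X) :
    (θ' m - θ' n) - (θ m - θ n) = -(Δb * (θ' p - θ' q)) * (u m - u n) := by
  have h1 := dcFlow_lineModification_transfer hL' hθ hθ'
  have h2 : (Matrix.diagonal (nodeConductance c) - c) *ᵥ (θ' - θ)
      = (Matrix.diagonal (nodeConductance c) - c) *ᵥ ((-(Δb * (θ' p - θ' q))) • u) := by
    rw [Matrix.mulVec_smul, hu, h1]
  obtain ⟨κ, hκ⟩ := (laplacian_mulVec_eq_mulVec_iff hc hG hconn _ _).1 h2.symm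
  have hm := hκ m
  have hn := hκ n
  simp only [Pi.sub_apply, Pi.smul_apply, smul_eq_mul] at hm hn
  linarith

/-- ★★ **A LINE UPGRADE DOES NOT PROPAGATE ACROSS A CUT VERTEX**: for any modification `Δb` of the pair
`{p,q}` (reinforcement, new parallel capacity, derating) and nodes `m`, `n` separated from `p`, `q` by
`a`: `θ'_m − θ'_n = θ_m − θ_n`, so no far-side flow changes (the induced cycle flow stays in the block).
[cite: SchaferEtAl2022, (arXiv:2209.13278 p0005 L18–L19); GuoEtAl2020, §4.2 Corollary 9 (arXiv:2005.10199 p0011 L30–L36)] -/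
theorem dcFlow_lineModification_angles_eq_of_separates (hc : IsConductance c) {G : SimpleGraph X}
    (hG : ∀ x y, G.Adj x y ↔ x ≠ y ∧ c x y ≠ 0) (hconn : G.Connected) {p q a m n : X} {Δb : ℝ}
    {L' : Matrix X X ℝ}
    (hL' : L' = (Matrix.diagonal (nodeConductance c) - c)
        + Δb • Matrix.vecMulVec (Pi.single p (1 : ℝ) - Pi.single q 1) (Pi.single p (1 : ℝ) - Pi.single q 1))
    {P θ θ' : X → ℝ} (hθ : (Matrix.diagonal (nodeConductance c) - c) *ᵥ θ = P) (hθ' : L' *ᵥ θ' = P)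
    (hmp : ∀ W : G.Walk m p, a ∈ W.support) (hmq : ∀ W : G.Walk m q, a ∈ W.support)
    (hnp : ∀ W : G.Walk n p, a ∈ W.support) (hnq : ∀ W : G.Walk n q, a ∈ W.support) :
    θ' m - θ' n = θ m - θ n ∧ c m n * ((θ' m - θ' n) - (θ m - θ n)) = 0 := by
  obtain ⟨u, hu⟩ := exists_transferPotential hc hG hconn p q
  have h := dcFlow_lineModification_angleChange hc hG hconn hL' hθ hθ' hu m n
  rw [(transferFactor_eq_zero_of_separates hc hG hconn hu hmp hmq hnp hnq).1, sub_self, mul_zero,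
    sub_eq_zero] at h
  exact ⟨h, by rw [h, sub_self, mul_zero]⟩

/-- ★★ **BRIDGES ARE BLIND TO OTHER LINES' MODIFICATIONS**: a bridge `{m,n}` keeps its angle difference
and flow under any modification `Δb` of a different line `{p,q}`.
[cite: GuoEtAl2020, §4.2 (arXiv:2005.10199 p0011 L31–L32); SchaferEtAl2022, (arXiv:2209.13278 p0005 L18–L19)] -/
theorem dcFlow_lineModification_bridgeFlow_eq (hc : IsConductance c) {G : SimpleGraph X}
    (hG : ∀ x y, G.Adj x y ↔ x ≠ y ∧ c x y ≠ 0) (hconn : G.Connected) {p q m n : X} (hmn : m ≠ n)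
    (hcmn : c m n ≠ 0) (hbr : ¬ (G.deleteEdges {s(m, n)}).Reachable m n) (hcpq : c p q ≠ 0)
    (hne : s(m, n) ≠ s(p, q)) {Δb : ℝ} {L' : Matrix X X ℝ}
    (hL' : L' = (Matrix.diagonal (nodeConductance c) - c)
        + Δb • Matrix.vecMulVec (Pi.single p (1 : ℝ) - Pi.single q 1) (Pi.single p (1 : ℝ) - Pi.single q 1))
    {P θ θ' : X → ℝ} (hθ : (Matrix.diagonal (nodeConductance c) - c) *ᵥ θ = P) (hθ' : L' *ᵥ θ' = P) :
    θ' m - θ' n = θ m - θ n ∧ c m n * (θ' m - θ' n) = c m n * (θ m - θ n) := by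
  obtain ⟨u, hu⟩ := exists_transferPotential hc hG hconn p q
  have h := dcFlow_lineModification_angleChange hc hG hconn hL' hθ hθ' hu m n
  rw [transferPotential_sub_eq_zero_of_bridge hc hG hconn hmn hcmn hbr hcpq hne hu, sub_self,
    mul_zero, sub_eq_zero] at h
  exact ⟨h, by rw [h]⟩

/-! ### §4. THE MODEL: two simultaneous outages in different blocks superpose -/

/-- ★★★ **N−2 ACROSS A CUT VERTEX: THE SINGLE-OUTAGE EFFECTS SUPERPOSE** (Theorem 10's block-diagonal
`K^F` for `|F| = 2`): if `a` separates the endpoints of `ℓ₂ = {r,s}` from those of `ℓ₁ = {p,q}`, then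
the cross factors vanish, `D₁₂ = D₂₁ = 0`, the islanding determinant factorises as `(1 − D₁₁)(1 −
D₂₂)`, and for every ordered pair `(m,n)`:
`(1 − D₁₁)(1 − D₂₂)·ΔF_mn = D_{(mn),1}(1 − D₂₂)·f₁ + D_{(mn),2}(1 − D₁₁)·f₂` — i.e. `ΔF_mn = K_{(mn),1}f₁ +
K_{(mn),2}f₂` with the two SINGLE-outage LODFs whenever both lines are non-bridges.
[cite: GuoEtAl2020, §4.2 Theorem 10 (arXiv:2005.10199 p0012 L37–L68), §3.3.2 Theorem 7 (p0009 L42–L65)] -/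
theorem dcFlow_doubleOutage_superposition_of_separates (hc : IsConductance c) {G : SimpleGraph X}
    (hG : ∀ x y, G.Adj x y ↔ x ≠ y ∧ c x y ≠ 0) (hconn : G.Connected) {p q r s a : X}
    {L'' : Matrix X X ℝ}
    (hL'' : L'' = (Matrix.diagonal (nodeConductance c) - c)
        - c p q • Matrix.vecMulVec (Pi.single p (1 : ℝ) - Pi.single q 1) (Pi.single p (1 : ℝ) - Pi.single q 1)
        - c r s • Matrix.vecMulVec (Pi.single r (1 : ℝ) - Pi.single s 1) (Pi.single r (1 : ℝ) - Pi.single s 1))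
    {P θ θ'' u w : X → ℝ} (hθ : (Matrix.diagonal (nodeConductance c) - c) *ᵥ θ = P)
    (hθ'' : L'' *ᵥ θ'' = P)
    (hu : (Matrix.diagonal (nodeConductance c) - c) *ᵥ u = Pi.single p 1 - Pi.single q 1)
    (hw : (Matrix.diagonal (nodeConductance c) - c) *ᵥ w = Pi.single r 1 - Pi.single s 1)
    (hrp : ∀ W : G.Walk r p, a ∈ W.support) (hrq : ∀ W : G.Walk r q, a ∈ W.support)
    (hsp : ∀ W : G.Walk s p, a ∈ W.support) (hsq : ∀ W : G.Walk s q, a ∈ W.support) :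
    c p q * (w p - w q) = 0 ∧ c r s * (u r - u s) = 0
    ∧ ((1 - c p q * (u p - u q)) * (1 - c r s * (w r - w s)) - (c p q * (w p - w q)) * (c r s * (u r - u s))
        = (1 - c p q * (u p - u q)) * (1 - c r s * (w r - w s)))
    ∧ ∀ m n : X,
      ((1 - c p q * (u p - u q)) * (1 - c r s * (w r - w s))) * (c m n * ((θ'' m - θ'' n) - (θ m - θ n)))
        = (c m n * (u m - u n)) * ((1 - c r s * (w r - w s)) * (c p q * (θ p - θ q)))
          + (c m n * (w m - w n)) * ((1 - c p q * (u p - u q)) * (c r s * (θ r - θ s))) := by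
  -- `D₂₁ = c_rs(u_r − u_s) = 0`: `r`, `s` lie beyond `a` for the `(p,q)` transfer
  have hD21 : u r = u s := (transferFactor_eq_zero_of_separates hc hG hconn hu hrp hrq hsp hsq).1
  -- `D₁₂ = c_pq(w_p − w_q) = 0` by reciprocity `w_p − w_q = u_r − u_s`
  have hrec : w p - w q = u r - u s := transferPotential_reciprocity hc hw hu
  have hD12' : w p - w q = 0 := by rw [hrec, hD21, sub_self]
  have hD21' : u r - u s = 0 := by rw [hD21, sub_self]
  obtain ⟨-, -, h3⟩ := dcFlow_doubleOutage_glodf hc hG hconn hL'' hθ hθ'' hu hw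
  refine ⟨by rw [hD12', mul_zero], by rw [hD21', mul_zero], by rw [hD12', hD21']; ring, fun m n => ?_⟩
  have h := h3 m n
  rw [hD12', hD21'] at h
  have h' : ((1 - c p q * (u p - u q)) * (1 - c r s * (w r - w s))) * (c m n * ((θ'' m - θ'' n) - (θ m - θ n)))
      = ((1 - c p q * (u p - u q)) * (1 - c r s * (w r - w s)) - (c p q * 0) * (c r s * 0))
          * (c m n * ((θ'' m - θ'' n) - (θ m - θ n))) := by ring
  rw [h', h]
  ring

end ClassicalModel

end Literature.MathematicalPhysics.PowerSystems

end
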